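/-
Copyright (c) 2026. All rights reserved.
Released under Apache 2.0 license as described in the file LICENSE.
Authors: abc-iut cell, statement-typer seat abc-iut-L4-t9 (wave 2, block W2-B2).
-/
import Mathlib.Combinatorics.Quiver.Prefunctor
import Mathlib.Logic.Function.Basic
import Mathlib.Data.Int.Notation
import Mathlib.Data.Nat.Notation
import HarnessLib

/-!
# [AbsTopIII] Corollary 3.7: the oriented graphs `Γ⃗_{𝒟†} ⊆ Γ⃗_{𝒟‡} ⊆ Γ⃗_{𝒟*}` (nexus `□`,
# `ℤ`-translation) and records of Remarks 3.7.1–3.7.4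

S. Mochizuki, *Topics in absolute anabelian geometry III: global reconstruction algorithms*,
J. Math. Sci. Univ. Tokyo 22 (2015) 939–1156 [MochizukiAbsTopIII2015]. Locators `p.N` are the pages
of the author's manuscript (`paper:url-5493eb38cbb7`, 164 pp.; journal pagination not held), read on
the page: Cor 3.7 pp. 86–88 (the diagrams `𝒟†`, `𝒟‡`, `𝒟‡_δ`, `𝒟*` and item (v)), nexus = §0
p. 27, Rmk 3.7.1 pp. 88–89, Rmk 3.7.2 pp. 89–90, Rmk 3.7.3 pp. 90–93, Rmk 3.7.4 pp. 93–94.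
Companion of `MonoAnabelianComparisonMLF.lean` (categories, functors, 2-cells of Cor 3.7).

* The ORIENTED GRAPH underlying the diagram of categories `𝒟*` of Cor 3.7 (ii) — which contains
  `Γ⃗_{𝒟†}` ("Consider the diagram of categories `𝒟†` `… 𝒳 ×_𝔈 𝒳 —log_𝒳→ 𝒳 ×_𝔈 𝒳 …` [row 1,
  vertices `⋎ ∈ L`, projections `pr_⋎` to] `𝒳` [row 2, the vertex `□`] `⇉ 𝒩 → 𝔈`", p. 86),
  `Γ⃗_{𝒟‡}` ("the result of appending these arrows `π_⋎` to `𝒟†` — where we think of the codomain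
  `𝒳` of the arrows `π_⋎` as a new 'core' vertex lying in the first row", p. 87), `Γ⃗_{𝒟‡_δ}` (the
  telecore edges `δ_⋎`) and the edge `δ_□` — as ONE explicit quiver `Cor37Vertex` / `Cor37Edge`,
  with membership predicates for the sub-diagrams (`InDagger`, `InDaggerLe n`, `InDDaggerLe n`,
  `Cor37Edge.InDagger/InDDagger/InDelta`). Row 1 is indexed by `L ≅ ℤ` ("the countably ordered set
  determined by the infinite linear oriented graph `Γ⃗^opp_{𝒟_{≤1}}`", Cor 3.6 p. 79; infinite in both
  directions, carrying the `ℤ`-translation of item (v)).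
* PROVED at graph level: the two defining conditions (a), (b) of a *nexus* (§0 p. 27: "(a) the
  oriented graph obtained by removing `v` [...] decomposes as a disjoint union of two nonempty
  oriented graphs `Γ⃗_{<v}`, `Γ⃗_{>v}`; (b) every edge [...] not contained in `Γ⃗_v` either runs from
  a vertex of `Γ⃗_{<v}` to `v` or from `v` to a vertex of `Γ⃗_{>v}`") for `□` in `Γ⃗_{𝒟*}` = Cor 3.7
  (v), first sentence (`Cor37Edge.box_nexus`, `Cor37Vertex.belowBox_aboveBox_partition`); and
  "the natural action of `ℤ` on the infinite linear oriented graph `Γ⃗_{𝒟†_{≤1}}`" extended to a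
  morphism of oriented graphs `Γ⃗_{𝒟*} → Γ⃗_{𝒟*}` fixing rows ≥ 2 (`Cor37Vertex.shift`, a bijection,
  additive in `k`).
  -- TODO-merge abc-iut-L4-t2: `IsNexus` / `IsTotallyNexusRigid` / nexus-classes of
  -- self-equivalences are Def 3.5 (vi) notions of t2's DiagramMorphisms.lean (not filed
  -- 2026-08-25T19:00Z); the diagram-of-categories half of Cor 3.7 (v) (total `□`-rigidity, `ℤ`
  -- acting by nexus-classes of self-equivalences of `𝒟*`) is typed in the sibling file
  -- `BiAnabelianIncompatibility.lean` over that API; here only the oriented-graph half.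
* Remarks 3.7.1–3.7.4 are expository; they are RECORDED as data (nothing asserted): 3.7.2
  (dictionary with `MF^∇`-objects), 3.7.3 (i) (conditions (a)/(b)/(c) vs items (i)–(iii)), 3.7.4
  (dichotomy (∗)/(∗∗)) as enumerations; 3.7.1, 3.7.3 (ii)–(iv) as constructors of `Rmk37Expository`.

Refereed pre-IUT anabelian geometry; nothing here bears on [IUTchIII] Cor. 3.12.
-/

set_option autoImplicit false

namespace Literature.AnabelianGeometry.AbsoluteAnabelian.AbsTopIII

universe w

/-! ## The oriented graphs `Γ⃗_{𝒟†} ⊆ Γ⃗_{𝒟‡} ⊆ Γ⃗_{𝒟*}` of Corollary 3.7 -/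

/-- The vertices of the oriented graph underlying the diagram of categories `𝒟*` of Cor 3.7 (ii)
(which contains `𝒟†`, `𝒟‡`, `𝒟‡_δ` as sub-graphs): the first row `first n`, `n ∈ L` — "`L` the
countably ordered set determined by the infinite linear oriented graph `Γ⃗^opp_{𝒟_{≤1}}`" (Cor 3.6
p. 79), realised as `ℤ` (infinite in both directions, carrying the `ℤ`-translation of Cor 3.7 (v));
`box` = "`□`, the unique vertex of the second row" (category `𝒳`); `space` = the third-row vertex
(category `𝒩`); `galois` = the fourth-row vertex (category `𝔈`); `ref` = the "new 'core' vertex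
lying in the first row of `𝒟‡` 'under' the various copies of `𝒳 ×_𝔈 𝒳`" (category `𝒳`, the
"universal reference model", Rmk 3.7.3). [cite: MochizukiAbsTopIII2015, Cor 3.7 p.86] -/
inductive Cor37Vertex : Type
  | first (n : ℤ)
  | box
  | space
  | galois
  | ref
  deriving DecidableEq

/-- The edges of `Γ⃗_{𝒟*}`: `log n` = "`log_𝒳`" from the vertex `⋎+1` to `⋎ = n` (an edge
`first m → first n` with `m = n + 1`; the endpoints are kept as separate indices so that the
`ℤ`-translation needs no casts); `pr n` = `pr_⋎`; `lamTimes`, `lamTimesPf` = `λ^×, λ^{×pf}`;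
`toGal` = `𝒩 → 𝔈`; `proj n` = "`π_⋎ : 𝒳 ×_𝔈 𝒳 → 𝒳`" (appended in `𝒟‡`); `diag n` = the telecore
edge "`δ_⋎`" from the core `ref` (appended in `𝒟‡_δ`); `diagBox` = the edge "`δ_□ : 𝒳 → 𝒳`"
given by a copy of the identity functor (appended in `𝒟*`). Edges live in an arbitrary universe `w`
(so that categories with `Type w`-valued hom-sets can be placed on the graph, as for abc-iut-L4-t2's
`LFVertex`). [cite: MochizukiAbsTopIII2015, Cor 3.7 (ii) p.87] -/
inductive Cor37Edge : Cor37Vertex → Cor37Vertex → Type w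
  | log (m n : ℤ) (h : m = n + 1) : Cor37Edge (.first m) (.first n)
  | pr (n : ℤ) : Cor37Edge (.first n) .box
  | lamTimes : Cor37Edge .box .space
  | lamTimesPf : Cor37Edge .box .space
  | toGal : Cor37Edge .space .galois
  | proj (n : ℤ) : Cor37Edge (.first n) .ref
  | diag (n : ℤ) : Cor37Edge .ref (.first n)
  | diagBox : Cor37Edge .ref .box

/-- `Γ⃗_{𝒟*}` as a quiver (edges in any universe `w`). [cite: MochizukiAbsTopIII2015, Cor 3.7 (ii) p.87] -/
instance Cor37Vertex.instQuiver : Quiver Cor37Vertex := ⟨Cor37Edge.{w}⟩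

namespace Cor37Vertex

/-- The row of a vertex of `𝒟†`/`𝒟*` (`ref` is placed in row 1, "lying in the first row of `𝒟‡`").
[cite: MochizukiAbsTopIII2015, Cor 3.7 p.87] -/
def row : Cor37Vertex → ℕ
  | first _ => 1
  | box => 2
  | space => 3
  | galois => 4
  | ref => 1

/-- Vertices of `𝒟†` (= `𝒟†_{≤4}`): everything except the appended core vertex `ref`.
[cite: MochizukiAbsTopIII2015, Cor 3.7 p.86] -/
def InDagger (a : Cor37Vertex) : Prop := a ≠ ref

/-- Vertices of `𝒟†_{≤n}`: "the subdiagram of categories determined by the first `n` rows".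
[cite: MochizukiAbsTopIII2015, Cor 3.7 p.86] -/
def InDaggerLe (n : ℕ) (a : Cor37Vertex) : Prop := a.InDagger ∧ a.row ≤ n

/-- Vertices of `𝒟‡_{≤n}` (`n ∈ {1,2,3,4}`): those of `𝒟†_{≤n}` together with the core vertex `ref`.
[cite: MochizukiAbsTopIII2015, Cor 3.7 p.87] -/
def InDDaggerLe (n : ℕ) (a : Cor37Vertex) : Prop := a.row ≤ n

/-- The pre-nexus side `Γ⃗_{<□}` of `Γ⃗_{𝒟*}`: row 1 (the copies of `𝒳 ×_𝔈 𝒳` and the core `ref`).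
[cite: MochizukiAbsTopIII2015, Cor 3.7 (v) p.88] -/
def BelowBox (a : Cor37Vertex) : Prop := a.row = 1

/-- The post-nexus side `Γ⃗_{>□}` of `Γ⃗_{𝒟*}`: rows 3–4 (`𝒩`, `𝔈`).
[cite: MochizukiAbsTopIII2015, Cor 3.7 (v) p.88] -/
def AboveBox (a : Cor37Vertex) : Prop := 3 ≤ a.row

/-- [cite: MochizukiAbsTopIII2015, Cor 3.7 (v) p.88] -/
instance (a : Cor37Vertex) : Decidable a.BelowBox := inferInstanceAs (Decidable (a.row = 1))
/-- [cite: MochizukiAbsTopIII2015, Cor 3.7 (v) p.88] -/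
instance (a : Cor37Vertex) : Decidable a.AboveBox := inferInstanceAs (Decidable (3 ≤ a.row))

/-- Nexus condition (a) of §0 p. 27 for `□`, vertex part: removing `□` leaves the disjoint union
of the two NONEMPTY vertex sets `Γ⃗_{<□}` (row 1) and `Γ⃗_{>□}` (rows 3–4).
[cite: MochizukiAbsTopIII2015, Cor 3.7 (v) p.88] -/
theorem belowBox_aboveBox_partition :
    (∀ a : Cor37Vertex, a ≠ box ↔ (a.BelowBox ∨ a.AboveBox)) ∧
    (∀ a : Cor37Vertex, ¬ (a.BelowBox ∧ a.AboveBox)) ∧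
    (first 0).BelowBox ∧ space.AboveBox := by
  refine ⟨fun a => ?_, fun a => ?_, rfl, ?_⟩
  · cases a <;> simp [BelowBox, AboveBox, row]
  · cases a <;> simp [BelowBox, AboveBox, row]
  · exact Nat.le_refl 3

end Cor37Vertex

namespace Cor37Edge

open Cor37Vertex

/-- Edges of `𝒟†`: `log_𝒳`, `pr_⋎`, `λ^×`, `λ^{×pf}`, `𝒩 → 𝔈`.
[cite: MochizukiAbsTopIII2015, Cor 3.7 p.86] -/
def InDagger : {a b : Cor37Vertex} → Cor37Edge a b → Prop
  | _, _, log _ _ _ => True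
  | _, _, pr _ => True
  | _, _, lamTimes => True
  | _, _, lamTimesPf => True
  | _, _, toGal => True
  | _, _, proj _ => False
  | _, _, diag _ => False
  | _, _, diagBox => False

/-- Edges of `𝒟‡`: those of `𝒟†` together with the projections `π_⋎`.
[cite: MochizukiAbsTopIII2015, Cor 3.7 p.87] -/
def InDDagger : {a b : Cor37Vertex} → Cor37Edge a b → Prop
  | _, _, diag _ => False
  | _, _, diagBox => False
  | _, _, _ => True

/-- Edges of `𝒟‡_δ`: those of `𝒟‡_{≤1}` (`log_𝒳`, `π_⋎`) together with the telecore edges `δ_⋎`.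
[cite: MochizukiAbsTopIII2015, Cor 3.7 (ii) p.87] -/
def InDelta : {a b : Cor37Vertex} → Cor37Edge a b → Prop
  | _, _, log _ _ _ => True
  | _, _, proj _ => True
  | _, _, diag _ => True
  | _, _, _ => False

/-- Every edge of `𝒟†` joins vertices of `𝒟†`, and `𝒟†_{≤n} ⊆ 𝒟†` is spanned on its vertices
(edges never increase the row by more than one and never leave `𝒟†`).
[cite: MochizukiAbsTopIII2015, Cor 3.7 p.86] -/
theorem inDagger_endpoints {a b : Cor37Vertex} (e : Cor37Edge a b) (he : e.InDagger) :
    a.InDagger ∧ b.InDagger ∧ a.row ≤ b.row := by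
  cases e <;> simp_all [InDagger, Cor37Vertex.InDagger, row]

/-- Nexus conditions for `□` in `Γ⃗_{𝒟*}` (§0 p. 27 (a), edge part, and (b)): every edge either
stays inside `Γ⃗_{<□}`, or stays inside `Γ⃗_{>□}`, or runs from `Γ⃗_{<□}` to `□`, or from `□` to
`Γ⃗_{>□}` — so `Γ⃗_{𝒟*} ∖ {□}` is the disjoint union of `Γ⃗_{<□}` and `Γ⃗_{>□}` and condition (b)
holds. This is the first sentence of Cor 3.7 (v): "The vertex `□` of the second row of `𝒟*` is a
nexus of `Γ⃗_{𝒟*}`", PROVED at the level of the oriented graph.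
-- TODO-merge abc-iut-L4-t2: restate as `IsNexus` of DiagramMorphisms.lean (Def 3.5 (vi)) when
-- that file lands; the two conditions proved here are its hypotheses.
[cite: MochizukiAbsTopIII2015, Cor 3.7 (v) p.88] -/
theorem box_nexus {a b : Cor37Vertex} (e : Cor37Edge a b) :
    (a.BelowBox ∧ b.BelowBox) ∨ (a.AboveBox ∧ b.AboveBox) ∨
      (a.BelowBox ∧ b = box) ∨ (a = box ∧ b.AboveBox) := by
  cases e <;> simp [BelowBox, AboveBox, row]

/-- No edge of `Γ⃗_{𝒟*}` ENTERS row 1 from outside row 1 and none leaves rows 3–4: the pre-nexus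
portion `Γ⃗_{≤□}` (rows 1–2) and the post-nexus portion `Γ⃗_{≥□}` (rows 2–4) meet exactly in `□`.
[cite: MochizukiAbsTopIII2015, Cor 3.7 (v) p.88] -/
theorem row_monotone {a b : Cor37Vertex} (e : Cor37Edge a b) : a.row ≤ b.row := by
  cases e <;> simp [row]

end Cor37Edge

namespace Cor37Vertex

/-- The `ℤ`-translation by `k` on vertices: `⋎ ↦ ⋎ + k` on the first row, the identity elsewhere
("the natural action of `ℤ` on the infinite linear oriented graph `Γ⃗_{𝒟†_{≤1}}`", Cor 3.7 (v)).
[cite: MochizukiAbsTopIII2015, Cor 3.7 (v) p.88] -/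
def shiftObj (k : ℤ) : Cor37Vertex → Cor37Vertex
  | first n => first (n + k)
  | box => box
  | space => space
  | galois => galois
  | ref => ref

/-- Translation on row 1. [cite: MochizukiAbsTopIII2015, Cor 3.7 (v) p.88] -/
@[simp] theorem shiftObj_first (k n : ℤ) : shiftObj k (first n) = first (n + k) := rfl

/-- The `ℤ`-translation on edges (`log`, `pr_⋎`, `π_⋎`, `δ_⋎` are shifted along; the edges of rows
≥ 2 and `δ_□` are fixed). [cite: MochizukiAbsTopIII2015, Cor 3.7 (v) p.88] -/
def shiftHom (k : ℤ) : {a b : Cor37Vertex} → (a ⟶ b) → (shiftObj k a ⟶ shiftObj k b)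
  | _, _, Cor37Edge.log m n h => Cor37Edge.log (m + k) (n + k) (by omega)
  | _, _, Cor37Edge.pr n => Cor37Edge.pr (n + k)
  | _, _, Cor37Edge.lamTimes => Cor37Edge.lamTimes
  | _, _, Cor37Edge.lamTimesPf => Cor37Edge.lamTimesPf
  | _, _, Cor37Edge.toGal => Cor37Edge.toGal
  | _, _, Cor37Edge.proj n => Cor37Edge.proj (n + k)
  | _, _, Cor37Edge.diag n => Cor37Edge.diag (n + k)
  | _, _, Cor37Edge.diagBox => Cor37Edge.diagBox

/-- Cor 3.7 (v), graph level: "the natural action of `ℤ` on the infinite linear oriented graph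
`Γ⃗_{𝒟†_{≤1}}` extends to [...] `𝒟*`" — the translation by `k ∈ ℤ` as a morphism of oriented graphs
`Γ⃗_{𝒟*} → Γ⃗_{𝒟*}` fixing every vertex outside row 1 (in particular the nexus `□`). The extension to
nexus-classes of SELF-EQUIVALENCES of the diagram of categories `𝒟*` is typed in the sibling file.
[cite: MochizukiAbsTopIII2015, Cor 3.7 (v) p.88] -/
def shift (k : ℤ) : Cor37Vertex ⥤q Cor37Vertex where
  obj := shiftObj k
  map := shiftHom k

/-- `shift` on vertices is `shiftObj`. [cite: MochizukiAbsTopIII2015, Cor 3.7 (v) p.88] -/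
@[simp] theorem shift_obj (k : ℤ) (a : Cor37Vertex) : (shift k).obj a = shiftObj k a := rfl

/-- The translation by `0` is the identity on vertices. [cite: MochizukiAbsTopIII2015, Cor 3.7 (v) p.88] -/
theorem shiftObj_zero (a : Cor37Vertex) : shiftObj 0 a = a := by
  cases a <;> simp [shiftObj]

/-- The translations compose additively on vertices (a `ℤ`-action).
[cite: MochizukiAbsTopIII2015, Cor 3.7 (v) p.88] -/
theorem shiftObj_add (j k : ℤ) (a : Cor37Vertex) :
    shiftObj k (shiftObj j a) = shiftObj (j + k) a := by
  cases a <;> simp only [shiftObj, Int.add_assoc]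

/-- Each translation is a bijection on vertices, with inverse the translation by `-k`.
[cite: MochizukiAbsTopIII2015, Cor 3.7 (v) p.88] -/
theorem shiftObj_bijective (k : ℤ) : Function.Bijective (shiftObj k) := by
  refine Function.bijective_iff_has_inverse.mpr ⟨shiftObj (-k), fun a => ?_, fun a => ?_⟩
  · rw [shiftObj_add, Int.add_right_neg, shiftObj_zero]
  · rw [shiftObj_add, Int.add_left_neg, shiftObj_zero]

/-- The translations fix the nexus `□` and preserve the pre-nexus and post-nexus sides.
[cite: MochizukiAbsTopIII2015, Cor 3.7 (v) p.88] -/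
theorem shiftObj_row (k : ℤ) (a : Cor37Vertex) : (shiftObj k a).row = a.row := by
  cases a <;> rfl

end Cor37Vertex

/-! ## Remarks 3.7.1–3.7.4 (expository; recorded)

The four Remarks make no numbered mathematical assertion (Rmk 3.7.8 p. 100: "Many of the arguments
in the various remarks following Corollaries 3.6, 3.7 are not formulated entirely rigorously"). They
are recorded as DATA: the purely discursive nodes as constructors of `Rmk37Expository` (locator +
thesis sentence), the three structured ones (3.7.2 dictionary, 3.7.3 (i) conditions, 3.7.4
dichotomy) as small enumerations with their printed correspondences. Nothing is asserted. -/

/-- The discursive (sub-)Remarks of [AbsTopIII] following Cor 3.7 that carry no extractable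
mathematical claim, one constructor per census node, each quoting its thesis sentence.
[cite: MochizukiAbsTopIII2015, Rmk 3.7.1 p.88] -/
inductive Rmk37Expository : Type
  /-- Rmk 3.7.1 p. 88: "the purpose of Corollary 3.7 is to examine what happens if the
  mono-anabelian theory of §1 is not available, i.e., if one is in a situation in which one may
  only apply the bi-anabelian version of this theory. This is the main reason for our assumption
  that '`T = T𝔽`' in Corollary 3.7 — that is to say, when `T = T𝕄`, one is obliged to apply
  Proposition 3.2, (v), a result whose proof requires one to invoke the mono-anabelian theory of
  §1." (Design consequence: `BiAnabelianSetting.logIsoId` is part of the input.) -/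
  | rmk_3_7_1
  /-- Rmk 3.7.3 (ii) p. 91: the mono-anabelian approach of Cor 3.6 summarised as
  `Π ⇝ (Π ↷ k̄^×_An) ⇝ (Π ↷ k̄^×_⋎ ↶ log) ⇝ Π ⇝ (Π ↷ k̄^×_An)`: "although `log` obliterates the ring
  structures involved, `𝔈` — i.e., 'Π' — remains constant [up to isomorphism] throughout [...];
  this implies that the 'purely group-theoretic constructions' of Corollary 1.10 — i.e., `Anab`,
  `κ_An` — also remain constant"; the incompatible composites of homotopies "become compatible as
  soon as one augments the various paths involved with a path back down to the core vertex
  `Anab`". -/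
  | rmk_3_7_3_ii
  /-- Rmk 3.7.3 (iii) p. 92: the bi-anabelian approach of Cor 3.7 summarised as
  `(Π ↷ k̄^×_model) ⇝ (Π ↷ k̄^×_⋎ ↶ log) ⇝ Π`: "if one tries to work with another model after
  applying `log`, then the `k̄^×_model` portion of this new model cannot be related to the
  `k̄^×_model` portion of the original model in a consistent fashion", "there is 'no escape route'
  in the bi-anabelian approach"; and the author's boxed, explicitly non-rigorous conclusion:
  "Although it is difficult to give a completely rigorous formulation of the question
  'bi-anabelian ⟹? mono-anabelian' raised in Remark 1.9.8, the state of affairs discussed above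
  strongly suggests a negative answer to this question." -/
  | rmk_3_7_3_iii
  /-- Rmk 3.7.3 (iv) pp. 92–93: the guiding questions "(a) In what capacity [...] does one
  transport [...] the fixed reference model of `k̄^×` down to 'future log-generations'? (b) On
  precisely what type of data does the comparison via telecore/contact structures depend?" — "in
  the mono-anabelian approach, the answer to both questions is given by `𝔈` [i.e., 'Π'], `Anab`;
  by contrast, in the bi-anabelian approach, the answer to (b) necessarily requires the inclusion
  of the 'model `k̄^×_model`' — a requirement that is incompatible with the coricity required by
  (a)"; Figure 1 "Mono-anabelian comparison only requires 'Galois input data'", Figure 2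
  "Bi-anabelian comparison requires 'arithmetic input data'". -/
  | rmk_3_7_3_iv
  deriving DecidableEq

/-- The six rows of the "dictionary" of Rmk 3.7.2 between the situation of Cors 3.6/3.7 and the
`p`-adic crystalline theory of `MF^∇`-objects. [cite: MochizukiAbsTopIII2015, Rmk 3.7.2 p.89] -/
inductive Rmk372Entry : Type
  /-- "the coricity of `𝔈` ⟷ absolutely unramified constants" -/
  | coricityOfGalois
  /-- "bi-anabelian isomorphism of projection functors ⟷ integrable connections" -/
  | projectionIsomorphism
  /-- "diagonal functor `δ_𝒳` telecore str. ⟷ Hodge filtration/section" -/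
  | diagonalTelecore
  /-- "bi-anabelian log-incompatibility ⟷ Kodaira-Spencer isomorphism" -/
  | biAnabelianLogIncompatibility
  /-- "'forgetful' functor `φ_An` telecore str. ⟷ underlying vector bundle of `MF^∇`-object" -/
  | forgetfulTelecore
  /-- "mono-anabelian log-compatibility ⟷ [positive slope!] uniformizing `MF^∇`-objects" -/
  | monoAnabelianLogCompatibility
  deriving DecidableEq

/-- Rmk 3.7.2 (RECORD of the printed dictionary, as data; the remark is an analogy — "The situation
under consideration in Corollaries 3.6, 3.7 is structurally reminiscent of the situation encountered
in the p-adic crystalline theory, for instance, when one considers the `MF^∇`-objects of [Falt]" —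
and makes no mathematical assertion): each row's crystalline analogue, verbatim.
[cite: MochizukiAbsTopIII2015, Rmk 3.7.2 p.89] -/
def Rmk372Entry.crystallineAnalogue : Rmk372Entry → String
  | coricityOfGalois => "absolutely unramified constants"
  | projectionIsomorphism => "integrable connections"
  | diagonalTelecore => "Hodge filtration/section"
  | biAnabelianLogIncompatibility => "Kodaira-Spencer isomorphism"
  | forgetfulTelecore => "underlying vector bundle of MF^∇-object"
  | monoAnabelianLogCompatibility => "[positive slope!] uniformizing MF^∇-objects"

/-- The three "main conditions that we wish to impose on the framework" of Rmk 3.7.3 (i): "(a)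
coricity of the model; (b) comparability of the model to log-subject copies of the model; (c)
consistent observability of the various operations executed [especially `log`]".
[cite: MochizukiAbsTopIII2015, Rmk 3.7.3 (i) p.90] -/
inductive Rmk373Condition : Type
  | coricity
  | comparability
  | observability
  deriving DecidableEq

/-- The items of Corollaries 3.6/3.7 that Rmk 3.7.3 (i) matches the conditions with.
[cite: MochizukiAbsTopIII2015, Rmk 3.7.3 (i) p.90] -/
inductive Rmk373Aspect : Type
  /-- "the coricity of (i)" -/
  | coricity_i
  /-- "the 'coricity portion' of the telecore structure of (ii)" (Def 3.5 (iv) (b)) -/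
  | telecoreCoricityPortion_ii
  /-- "the telecore and contact structures/families of homotopies of (ii)" -/
  | telecoreContact_ii
  /-- "the 'log-observable' of (iii)" -/
  | logObservable_iii
  deriving DecidableEq

/-- Rmk 3.7.3 (i) (RECORD of the printed correspondence, as data): "(a) ⟷ the coricity of (i), the
'coricity portion' of the telecore structure of (ii), (b) ⟷ the telecore and contact structures /
families of homotopies of (ii), (c) ⟷ the 'log-observable' of (iii)"; the remark adds that "the
second incompatibility of assertion (iv) of Corollaries 3.6, 3.7 asserts, in effect, that neither
of the approaches of these two corollaries succeeds in simultaneously realizing conditions (a),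
(b), (c), in the strict sense" — in Cor 3.7 "the 'fixed reference model' is realized by applying a
'category-theoretic base-change' `(−) ×_𝔈 𝒳`". No mathematical assertion beyond Cor 3.7 itself.
[cite: MochizukiAbsTopIII2015, Rmk 3.7.3 (i) p.90] -/
def Rmk373Condition.aspects : Rmk373Condition → List Rmk373Aspect
  | coricity => [.coricity_i, .telecoreCoricityPortion_ii]
  | comparability => [.telecoreContact_ii]
  | observability => [.logObservable_iii]

/-- The two "mutually exclusive choices" of the flowchart of Rmk 3.7.4 concerning a model "that may
be constructed without essential use of 'Π'". [cite: MochizukiAbsTopIII2015, Rmk 3.7.4 p.94] -/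
inductive Rmk374Choice : Type
  /-- "(∗) the model arises from 'Π' ⟹ 'functorially trivial model'" -/
  | arisesFromPi
  /-- "(∗∗) the model does not arise from 'Π' ⟹ 'bi-anabelian approach'" -/
  | doesNotAriseFromPi
  deriving DecidableEq

/-- Rmk 3.7.4 (RECORD of the printed dichotomy, as data; expository): the consequence the flowchart
attaches to each choice — "construction of model [universal pro-covering] schemes without essential
use of Π ⟹ natural functorial action of Π on model scheme is trivial ⟹ must supplement model scheme
with Π ⥲ Gal(model scheme) ⟹ essentially equivalent situation to 'bi-anabelian approach'"; "In
particular, Figures 1 and 2 of Remark 3.7.3, (iv), are not [at least in an 'a priori sense']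
'essentially equivalent'." No mathematical assertion. [cite: MochizukiAbsTopIII2015, Rmk 3.7.4 p.94] -/
def Rmk374Choice.consequence : Rmk374Choice → String
  | arisesFromPi => "functorially trivial model"
  | doesNotAriseFromPi => "bi-anabelian approach"

end Literature.AnabelianGeometry.AbsoluteAnabelian.AbsTopIII
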